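import Mathlib.Topology.Algebra.Valued.ValuedField
import Mathlib.FieldTheory.IntermediateField.Adjoin.Basic
import Mathlib.Data.NNReal.Basic
import HarnessLib

/-!
# Crux `Steer` (stmt-ResolutionOfSingularities-16345), chain W4.1, NSCᴹ line — habitat lemma (‡ᵇ) **monomial density**, PART A
# (sections A–C: multiplicative Lipschitz estimates, polynomials in the monomials, valued-field topology)
# (res-L0-w41-idea-2 card 3 `far-frame-exit-budget`, HABITAT.md v3 §2″; typer-ready, Theses-free, definition-free)

OURS (campaign `res-hironaka`, rung L ★L-G4, slot W4.1; NOT a statement of the manuscript under review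
[claim: Hironaka2017, status: under-review] — nothing of it is used; AI-produced, weaker than expert review).

`monomialDensity`: in a valued field `C` with values in `ℝ≥0`, let `k'` be a trivially valued subfield and `s₁ … s_d`
nonzero elements with `ℤ`-independent values such that the subfield `k'(s)` is dense in `C`.  Then every intermediate
field `L ⊇ k'` whose value set contains each `v (s i)` is dense in `C`.  (No completeness, no series: rational
approximants, dominant terms, a multiplicative Lipschitz estimate under substitution, a doubling step, archimedean `ℝ≥0`.)
This is the hypothesis `MonomialCompletionDensity` of `HabitatClaim` (idea-2 Sketch-idea-2i §I9) with `[CompleteSpace C]`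
dropped. [folklore] OURS.

Authorship: statement & proof res-L0-w41-idea-2 g9 (`L/res-L0-w41-idea-2/FrobeniusClosingSteerMonomialDensity.lean` f6cd398fe3aa92c5),
filed by res-type-026 per res-L0-w41-plan-1 RULING 97 (no edits beyond hygiene: docstrings added to helper lemmas, and the file SPLIT
at section C/D for the 400-line rule — THIS is the part with sections A–C; sections D–E and `monomialDensity` live in `…MonomialDensity`; names and namespace unchanged).
-/

open scoped NNReal
open MvPolynomial

set_option linter.dupNamespace false

namespace Summit.ResolutionOfSingularities.ResolutionOfSingularities.Cruxes.Steer.MonomialDensity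

namespace MonomialDensityProof

variable {C : Type*} [Field C]

/-! ### A. Multiplicative Lipschitz estimates for a valuation -/

section Lipschitz

variable (v : Valuation C ℝ≥0)

/-- An element approximating `t ≠ 0` to relative precision `ρ < 1` has the same value. [folklore] -/
theorem map_eq_of_approx {ρ : ℝ≥0} (hρ : ρ < 1) {b t : C} (ht : t ≠ 0)
    (hb : v (b - t) ≤ ρ * v t) : v b = v t := by
  apply Valuation.map_eq_of_sub_lt
  have h0 : 0 < v t := (Valuation.pos_iff v).mpr ht
  calc v (b - t) ≤ ρ * v t := hb
    _ < v t := mul_lt_of_lt_one_left h0 hρ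

/-- An element approximating `t ≠ 0` to relative precision `ρ < 1` is nonzero. [folklore] -/
theorem ne_zero_of_approx {ρ : ℝ≥0} (hρ : ρ < 1) {b t : C} (ht : t ≠ 0)
    (hb : v (b - t) ≤ ρ * v t) : b ≠ 0 := by
  intro hb0
  have h := map_eq_of_approx v hρ ht hb
  rw [hb0, map_zero] at h
  exact ((Valuation.ne_zero_iff v).mpr ht) h.symm

/-- Relative approximation to precision `ρ < 1` is stable under products (multiplicative Lipschitz estimate). [folklore] -/
theorem approx_mul {ρ : ℝ≥0} (hρ : ρ < 1) {a s b t : C}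
    (ha : v (a - s) ≤ ρ * v s) (hb : v (b - t) ≤ ρ * v t) :
    v (a * b - s * t) ≤ ρ * v (s * t) := by
  have hbt : v b = v t := by
    rcases eq_or_ne t 0 with rfl | h0
    · have h1 : v b ≤ 0 := by simpa using hb
      have h2 : v b = 0 := le_antisymm h1 zero_le
      simp [h2]
    · exact map_eq_of_approx v hρ h0 hb
  have h1 : a * b - s * t = (a - s) * b + s * (b - t) := by ring
  rw [h1]
  refine Valuation.map_add_le v ?_ ?_
  · rw [map_mul, hbt, map_mul, ← mul_assoc]
    exact mul_le_mul_left ha _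
  · rw [map_mul, map_mul, mul_left_comm]
    exact mul_le_mul_right hb _

/-- Relative approximation to precision `ρ < 1` is stable under powers. [folklore] -/
theorem approx_pow {ρ : ℝ≥0} (hρ : ρ < 1) {a s : C} (ha : v (a - s) ≤ ρ * v s) (m : ℕ) :
    v (a ^ m - s ^ m) ≤ ρ * v (s ^ m) := by
  induction m with
  | zero => simp
  | succ m ih =>
    rw [pow_succ, pow_succ]
    exact approx_mul v hρ ih ha

/-- Relative approximation to precision `ρ < 1` is stable under finite products. [folklore] -/
theorem approx_prod {ρ : ℝ≥0} (hρ : ρ < 1) {ι : Type*} (t : Finset ι) {f g : ι → C}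
    (h : ∀ i ∈ t, v (f i - g i) ≤ ρ * v (g i)) :
    v (∏ i ∈ t, f i - ∏ i ∈ t, g i) ≤ ρ * v (∏ i ∈ t, g i) := by
  classical
  induction t using Finset.induction_on with
  | empty => simp
  | insert j t hj ih =>
    rw [Finset.prod_insert hj, Finset.prod_insert hj]
    exact approx_mul v hρ (h j (Finset.mem_insert_self j t))
      (ih fun i hi => h i (Finset.mem_insert_of_mem hi))

/-- Relative approximation to precision `ρ < 1` is stable under quotients (nonzero denominators). [folklore] -/
theorem approx_div {ρ : ℝ≥0} (hρ : ρ < 1) {y y' z z' : C} (hz : z ≠ 0)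
    (hy : v (y' - y) ≤ ρ * v y) (hz' : v (z' - z) ≤ ρ * v z) :
    v (y' / z' - y / z) ≤ ρ * v (y / z) := by
  have hvz : v z' = v z := map_eq_of_approx v hρ hz hz'
  have hz'0 : z' ≠ 0 := ne_zero_of_approx v hρ hz hz'
  have hvz0 : 0 < v z := (Valuation.pos_iff v).mpr hz
  have hD : (y' / z' - y / z) * (z' * z) = y' * z - z' * y := by
    rw [div_sub_div _ _ hz'0 hz, div_mul_cancel₀ _ (mul_ne_zero hz'0 hz)]
  have hnum : v (y' * z - z' * y) ≤ ρ * (v y * v z) := by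
    have h1 : y' * z - z' * y = (y' - y) * z - (z' - z) * y := by ring
    rw [h1]
    refine Valuation.map_sub_le v ?_ ?_
    · rw [map_mul, ← mul_assoc]
      exact mul_le_mul_left hy _
    · rw [map_mul]
      calc v (z' - z) * v y ≤ ρ * v z * v y := mul_le_mul_left hz' _
        _ = ρ * (v y * v z) := by ring
  have key : v (y' / z' - y / z) * (v z * v z) ≤ ρ * v (y / z) * (v z * v z) := by
    calc v (y' / z' - y / z) * (v z * v z)
        = v ((y' / z' - y / z) * (z' * z)) := by rw [map_mul, map_mul, hvz]
      _ = v (y' * z - z' * y) := by rw [hD]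
      _ ≤ ρ * (v y * v z) := hnum
      _ = ρ * (v (y / z) * v z * v z) := by rw [← map_mul v (y / z) z, div_mul_cancel₀ y hz]
      _ = ρ * v (y / z) * (v z * v z) := by ring
  exact le_of_mul_le_mul_right key (mul_pos hvz0 hvz0)

end Lipschitz

/-! ### B. Polynomials in the monomials `s` with coefficients in `k'` -/

section Poly

variable (v : Valuation C ℝ≥0) (k' : Subfield C) {d : ℕ} (s : Fin d → C)

/-- Value of a monomial in the elements `a i`. [folklore] -/
theorem v_monomial (a : Fin d → C) (n : Fin d →₀ ℕ) :
    v (∏ i, a i ^ (n i)) = ∏ i, v (a i) ^ (n i) := by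
  rw [map_prod]
  simp only [map_pow]

/-- The value of a monomial in nonzero elements is nonzero. [folklore] -/
theorem termVal_ne_zero (hs : ∀ i, s i ≠ 0) (n : Fin d →₀ ℕ) :
    (∏ i, v (s i) ^ (n i)) ≠ 0 :=
  Finset.prod_ne_zero_iff.mpr fun i _ => pow_ne_zero _ ((Valuation.ne_zero_iff v).mpr (hs i))

/-- Injectivity of monomial values from `ℤ`-independence of the values `v (s i)`. -/
theorem termVal_inj (hs : ∀ i, s i ≠ 0)
    (hind : ∀ n : Fin d → ℤ, (∏ i, v (s i) ^ (n i)) = 1 → n = 0)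
    {n m : Fin d →₀ ℕ} (h : ∏ i, v (s i) ^ (n i) = ∏ i, v (s i) ^ (m i)) : n = m := by
  have hne : ∀ i, v (s i) ≠ 0 := fun i => (Valuation.ne_zero_iff v).mpr (hs i)
  have hz := hind (fun i => (n i : ℤ) - (m i : ℤ)) (by
    calc ∏ i, v (s i) ^ ((n i : ℤ) - (m i : ℤ))
        = ∏ i, (v (s i) ^ (n i) * (v (s i) ^ (m i))⁻¹) := by
          refine Finset.prod_congr rfl fun i _ => ?_
          rw [zpow_sub₀ (hne i), zpow_natCast, zpow_natCast, div_eq_mul_inv]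
      _ = (∏ i, v (s i) ^ (n i)) * (∏ i, v (s i) ^ (m i))⁻¹ := by
          rw [Finset.prod_mul_distrib, Finset.prod_inv_distrib]
      _ = 1 := by
          rw [h]
          exact mul_inv_cancel₀ (termVal_ne_zero v s hs m))
  ext i
  have hi := congr_fun hz i
  simp only [Pi.zero_apply, sub_eq_zero, Nat.cast_inj] at hi
  exact hi

/-- The range of the algebra map of a subfield is the subfield. [folklore] -/
theorem range_algebraMap_subfield : Set.range (algebraMap k' C) = (k' : Set C) := by
  ext y
  constructor
  · rintro ⟨c, rfl⟩
    exact c.2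
  · intro hy
    exact ⟨⟨y, hy⟩, rfl⟩

/-- Elements of the subfield generated by `k'` and the `s i` are quotients of polynomial
expressions in `s` with coefficients in `k'`. -/
theorem mem_closure_iff_aeval {x : C} :
    x ∈ Subfield.closure ((k' : Set C) ∪ Set.range s) ↔
      ∃ Y Z : MvPolynomial (Fin d) k', x = aeval s Y / aeval s Z := by
  rw [← IntermediateField.mem_adjoin_range_iff k' s x, ← IntermediateField.mem_toSubfield,
    IntermediateField.adjoin_toSubfield, range_algebraMap_subfield]

/-- Evaluation of a polynomial as the sum of its terms. [folklore] -/
theorem aeval_eq_sum (Y : MvPolynomial (Fin d) k') (a : Fin d → C) :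
    aeval a Y = ∑ n ∈ Y.support, ((Y.coeff n : k') : C) * ∏ i, a i ^ (n i) := by
  rw [MvPolynomial.aeval_def, MvPolynomial.eval₂_eq']
  rfl

/-- Evaluating a polynomial with coefficients in `k' ≤ L` at arguments in `L` stays in `L`. [folklore] -/
theorem aeval_mem {L : Subfield C} (hkL : k' ≤ L) (Y : MvPolynomial (Fin d) k')
    {a : Fin d → C} (ha : ∀ i, a i ∈ L) : aeval a Y ∈ L := by
  rw [aeval_eq_sum]
  exact sum_mem fun n _ => mul_mem (hkL (Y.coeff n).2) (prod_mem fun i _ => pow_mem (ha i) _)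

/-- Nonzero coefficients from the trivially valued subfield have value `1`. [folklore] -/
theorem v_coeff (hk : ∀ c ∈ k', c ≠ 0 → v c = 1) {c : k'} (hc : c ≠ 0) : v (c : C) = 1 :=
  hk c c.2 (by simpa using hc)

/-- Value of a term of a polynomial with trivially valued coefficients. [folklore] -/
theorem v_term (hk : ∀ c ∈ k', c ≠ 0 → v c = 1) {Y : MvPolynomial (Fin d) k'}
    {n : Fin d →₀ ℕ} (hn : n ∈ Y.support) :
    v (((Y.coeff n : k') : C) * ∏ i, s i ^ (n i)) = ∏ i, v (s i) ^ (n i) := by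
  rw [map_mul, v_coeff v k' hk (MvPolynomial.mem_support_iff.mp hn), one_mul, v_monomial]

/-- Dominant term: for `Y ≠ 0` there is a unique exponent of maximal monomial value; it
computes `v (aeval s Y)` and strictly dominates the rest. -/
theorem exists_dominant (hk : ∀ c ∈ k', c ≠ 0 → v c = 1) (hs : ∀ i, s i ≠ 0)
    (hind : ∀ n : Fin d → ℤ, (∏ i, v (s i) ^ (n i)) = 1 → n = 0)
    {Y : MvPolynomial (Fin d) k'} (hY : Y ≠ 0) :
    ∃ n₀ ∈ Y.support, (∀ n ∈ Y.support, ∏ i, v (s i) ^ (n i) ≤ ∏ i, v (s i) ^ (n₀ i)) ∧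
      v (aeval s Y) = ∏ i, v (s i) ^ (n₀ i) ∧
      v (aeval s Y - ((Y.coeff n₀ : k') : C) * ∏ i, s i ^ (n₀ i)) < ∏ i, v (s i) ^ (n₀ i) := by
  classical
  obtain ⟨n₀, hn₀, hmax⟩ := Finset.exists_max_image Y.support
    (fun n => ∏ i, v (s i) ^ (n i)) (MvPolynomial.support_nonempty.mpr hY)
  have hlt : ∀ n ∈ Y.support, n ≠ n₀ → ∏ i, v (s i) ^ (n i) < ∏ i, v (s i) ^ (n₀ i) :=
    fun n hn hne => lt_of_le_of_ne (hmax n hn) fun h => hne (termVal_inj v s hs hind h)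
  refine ⟨n₀, hn₀, hmax, ?_, ?_⟩
  · rw [aeval_eq_sum, ← v_term v k' s hk hn₀]
    apply Valuation.map_sum_eq_of_lt v hn₀
    intro n hn
    rw [Finset.mem_sdiff, Finset.mem_singleton] at hn
    rw [v_term v k' s hk hn.1, v_term v k' s hk hn₀]
    exact hlt n hn.1 hn.2
  · rw [aeval_eq_sum, ← Finset.sum_erase_add _ _ hn₀, add_sub_cancel_right]
    apply Valuation.map_sum_lt _ (termVal_ne_zero v s hs n₀)
    intro n hn
    rw [Finset.mem_erase] at hn
    rw [v_term v k' s hk hn.2]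
    exact hlt n hn.2 hn.1

/-- Substitution Lipschitz estimate: replacing `s` by a relative `ρ`-approximation `a`
changes `aeval _ Y` by at most `ρ · v (aeval s Y)`. -/
theorem approx_aeval (hk : ∀ c ∈ k', c ≠ 0 → v c = 1) (hs : ∀ i, s i ≠ 0)
    (hind : ∀ n : Fin d → ℤ, (∏ i, v (s i) ^ (n i)) = 1 → n = 0)
    {ρ : ℝ≥0} (hρ : ρ < 1) {a : Fin d → C} (ha : ∀ i, v (a i - s i) ≤ ρ * v (s i))
    (Y : MvPolynomial (Fin d) k') :
    v (aeval a Y - aeval s Y) ≤ ρ * v (aeval s Y) := by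
  classical
  rcases eq_or_ne Y 0 with rfl | hY
  · simp
  obtain ⟨n₀, hn₀, hmax, hval, -⟩ := exists_dominant v k' s hk hs hind hY
  rw [hval, aeval_eq_sum, aeval_eq_sum, ← Finset.sum_sub_distrib]
  apply Valuation.map_sum_le
  intro n hn
  rw [← mul_sub, map_mul, v_coeff v k' hk (MvPolynomial.mem_support_iff.mp hn), one_mul]
  calc v (∏ i, a i ^ (n i) - ∏ i, s i ^ (n i)) ≤ ρ * v (∏ i, s i ^ (n i)) :=
        approx_prod v hρ _ fun i _ => approx_pow v hρ (ha i) (n i)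
    _ = ρ * ∏ i, v (s i) ^ (n i) := by rw [v_monomial]
    _ ≤ ρ * ∏ i, v (s i) ^ (n₀ i) := mul_le_mul_right (hmax n hn) _

end Poly

/-! ### C. Topology of a valued field: approximation and closure -/

section Topology

variable [Valued C ℝ≥0]

/-- In a valued field, a dense set approximates every element to within any nonzero value. [folklore] -/
theorem exists_approx_of_dense {S : Set C} (hS : Dense S) (x : C) {w : C} (hw : w ≠ 0) :
    ∃ a ∈ S, Valued.v (a - x) < Valued.v w := by
  have hx : x ∈ closure S := hS x
  rw [mem_closure_iff_nhds] at hx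
  have hw' : (Valued.v.restrict w : MonoidWithZeroHom.ValueGroup₀
      (MonoidWithZeroHom.ofClass (Valued.v : Valuation C ℝ≥0))) ≠ 0 := by
    rw [ne_eq, Valuation.restrict_eq_zero_iff]
    exact (Valuation.ne_zero_iff _).mpr hw
  obtain ⟨a, hat, haS⟩ := hx {y | Valued.v.restrict (y - x) < (Units.mk0 _ hw').1}
    (Valued.mem_nhds.mpr ⟨Units.mk0 _ hw', subset_rfl⟩)
  refine ⟨a, haS, ?_⟩
  rw [Set.mem_setOf_eq, Units.val_mk0] at hat
  exact (Valuation.restrict_lt_iff Valued.v).mp hat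

/-- Closure membership from approximations to within every positive value. [folklore] -/
theorem mem_closure_of_forall {S : Set C} {x : C}
    (h : ∀ γ : ℝ≥0, 0 < γ → ∃ a ∈ S, Valued.v (a - x) < γ) : x ∈ closure S := by
  rw [mem_closure_iff_nhds]
  intro t ht
  obtain ⟨γ, hγ⟩ := Valued.mem_nhds.mp ht
  have hpos : 0 < (MonoidWithZeroHom.ValueGroup₀.embedding γ.1 : ℝ≥0) := by
    rw [pos_iff_ne_zero]
    exact (map_ne_zero_iff _ MonoidWithZeroHom.ValueGroup₀.embedding_injective).mpr γ.ne_zero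
  obtain ⟨a, haS, ha⟩ := h _ hpos
  exact ⟨a, hγ ((Valuation.restrict_lt_iff_lt_embedding Valued.v).mpr ha), haS⟩

end Topology

/-! ## v2 (append) — typing bridge (res-L0-w41-tri-2 TRIAGE v12 R3 (ii)): density ⟺ the approximation clause

So that consumers holding the tree's `DenseAbhyankar`-style clause «`∀ x w, w ≠ 0 → ∃ a ∈ S, v (a - x) < v w`» can feed / read
`monomialDensity`'s `Dense` hypotheses and conclusion. [folklore] OURS (res-type-026 after-care 11:43Z). -/

section Bridge

variable [Valued C ℝ≥0]

/-- In a valued field with values in `ℝ≥0`, either the valuation is trivial on units (every nonzero element has value `1`) or there are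
nonzero elements of arbitrarily small value. [folklore] -/
theorem trivial_or_exists_small :
    (∀ w : C, w ≠ 0 → Valued.v w = 1) ∨ ∀ γ : ℝ≥0, 0 < γ → ∃ w : C, w ≠ 0 ∧ Valued.v w < γ := by
  by_cases h : ∀ w : C, w ≠ 0 → Valued.v w = 1
  · exact Or.inl h
  · right
    push Not at h
    obtain ⟨w, hw0, hw1⟩ := h
    -- some nonzero element has value `< 1`: `w` or `w⁻¹`
    obtain ⟨u, hu0, hu1⟩ : ∃ u : C, u ≠ 0 ∧ Valued.v u < 1 := by
      rcases lt_or_gt_of_ne hw1 with hlt | hgt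
      · exact ⟨w, hw0, hlt⟩
      · refine ⟨w⁻¹, inv_ne_zero hw0, ?_⟩
        rw [map_inv₀]
        exact inv_lt_one_of_one_lt₀ hgt
    intro γ hγ
    obtain ⟨n, hn⟩ := NNReal.exists_pow_lt_of_lt_one hγ hu1
    refine ⟨u ^ n, pow_ne_zero n hu0, ?_⟩
    rw [map_pow]
    exact hn

/-- **Density ⟺ approximation.** A subset `S` of a valued field `C` (values in `ℝ≥0`) is dense iff every element of `C` is approximated
from `S` to within the value of every nonzero element: `Dense S ↔ ∀ x w, w ≠ 0 → ∃ a ∈ S, v (a - x) < v w`. (`⇒`: `exists_approx_of_dense`;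
`⇐`: if values accumulate at `0` use `mem_closure_of_forall`, and if the valuation is trivial the clause forces `x ∈ S`.) [folklore] -/
theorem dense_iff_forall_exists_approx (S : Set C) :
    Dense S ↔ ∀ x w : C, w ≠ 0 → ∃ a ∈ S, Valued.v (a - x) < Valued.v w := by
  constructor
  · intro hS x w hw
    exact exists_approx_of_dense hS x hw
  · intro h x
    rcases trivial_or_exists_small (C := C) with htriv | hsmall
    · -- trivial valuation: `v (a - x) < v 1 = 1` forces `a = x`, so `x ∈ S`
      obtain ⟨a, haS, ha⟩ := h x 1 one_ne_zero
      have hax : a - x = 0 := by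
        by_contra hne
        rw [htriv _ hne, htriv 1 one_ne_zero] at ha
        exact lt_irrefl _ ha
      rw [sub_eq_zero] at hax
      rw [← hax]
      exact subset_closure haS
    · refine mem_closure_of_forall fun γ hγ => ?_
      obtain ⟨w, hw0, hwγ⟩ := hsmall γ hγ
      obtain ⟨a, haS, ha⟩ := h x w hw0
      exact ⟨a, haS, ha.trans hwγ⟩

end Bridge

end MonomialDensityProof

end Summit.ResolutionOfSingularities.ResolutionOfSingularities.Cruxes.Steer.MonomialDensity
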